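import Summits.QuantumFields.YangMills.Theorems.BalabanUVNodesN15KingModelBoxResolvent
import Summits.QuantumFields.YangMills.Theorems.BalabanUVNodesN15KingModelTorusTimeSlices
import Summits.QuantumFields.YangMills.Theorems.BalabanUVNodesN15KingModelPathResolvent
import HarnessLib

/-!
# BalabanUVNodes ∕ N15 — THE KING-MODEL RUNG (PART Ν-b, v1.1 doc-only erratum): THE REFLECTED BOXES TILE THE DOUBLED TORUS, AND THE ZERO-MOMENTUM TIMESLICES OF KING's
# FREE-BOUNDARY BOX COVARIANCE ARE THE ONE-DIMENSIONAL NEUMANN RESOLVENT WITH THE TORUS MASS: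
# `Σ_{s′ ∈ Ω : s′_κ = a} (c(−Δ_free)+m²)⁻¹(s′,t) = c⁻¹·cosh(ω₀(min(a,t_κ)+½))cosh(ω₀(n_κ−½−max(a,t_κ)))∕(sinh ω₀ sinh(ω₀n_κ))`, `ω₀ = latticeMass(m²∕c)`
# (Track A, DAG node N15 = NE2; FAN-OUT v1.1 §N15 s3 «KING-MODEL RUNG» — «torus-vs-box twin»; count-neutral)

HONEST FRAMING.  Count-neutral (cell `pub-ymgap`, seat `pub-ymgap-dag-n15-e` g39; `--supports stmt-QuantumFields-27366 --as helper` = K3⁸).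
TEMPLATE LITERATURE: C. King, Commun. Math. Phys. **102** (1986) 649–677 [King1986] §4 p.670 l.8–13 (the Ω-propagators as multiple-reflection sums
after [Ba 4] = [Balaban1983RegularityDecay] (2.42) — the infinite-lattice series, of which parts Ν-a∕Ν-a′ type the periodized doubled-TORUS form; see part
Ν-a v1.1's ATTRIBUTION paragraph; v1.1 of this file: doc-only erratum, decls byte-identical); Montvay–Münster [MontvayMunster1994] §2.1.2∕§2.2.1 (timeslice correlations, lattice mass).  Over parts Ν-a∕Ν-a′
(`boxOp⁻¹ = kingBoxGreen = Σ_S B⁻¹_{T(2n)}(·, σ_S ·)`), Ϲ-b (`…TorusTimeSlices`: every zero-momentum timeslice of King's torus covariance is the cycle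
resolvent, `timeSlice_lapF_inv_eq_cycleGreen_source`) and Ϲ-g (`…PathResolvent`: the `d = 1` Neumann resolvent `pathGreen = G_{2n}(s−t) + G_{2n}(s+t+1)`
with its `cosh·cosh` closed form) THIS FILE proves: (§1) THE TILING — `(S, s) ↦ σ_S(dblBox s)` is a bijection `𝒫({0,…,d}) × Ω ≃ Π_μ ℤ∕2n_μ`
(`tilingEquiv`; inverse = mirror-half set `highSet` + folding `foldBox`), so every sum over the doubled torus is a sum over the `2^{d+1}` reflected boxes
and `G^{Ω}(s,t) = Σ_{w : foldBox w = t} B⁻¹_{T(2n)}(dblBox s, w)` (fibre form); (§2) a folded slice `{(foldBox w)_κ = a}` is the disjoint union of the two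
torus slices `{w_κ = a}`, `{w_κ = −1−a}`; (§3) ★★★ **`timeSlice_kingBoxGreen_eq_pathGreen`**: summing the box covariance over a transverse box slice and
unfolding, the transverse free faces DROP OUT (the folded transverse sum is the full transverse torus sum) and the two `κ`-slices give part Ϲ-b's cycle
resolvent of period `2n_κ` at `a − t_κ` and at `a + t_κ + 1`: EXACTLY part Ϲ-g's one-dimensional Neumann resolvent `c⁻¹·pathGreen (n κ) (m²∕c) a t_κ`, with
the SAME lattice mass `ω₀ = latticeMass(m²∕c)` as King's torus (`2 sinh(ω₀∕2) = √(m²∕c)`) — the free boundary changes the images, not the gap.  Closed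
form (`…_eq_cosh_mul_cosh`), strict positivity, the «two torus slices» form, and `Σ_{t∈Ω} G^{Ω}(s,t) = Σ_{w∈T(2n)} B⁻¹(dblBox s, w)`.
NOT Bałaban's covariant objects; NOT a node discharge (N15 is booked through n15-a's knit, untouched); no transfer operator on the box is constructed;
nothing continuum-YM ∕ `ℝ⁴` ∕ OS axioms ∕ Clay.  0 `sorry`.  PRIOR TREE ART as named in part Ν-a (AllWindowsColdBox's massless signed image sum;
dag-n15-a's `Sym∘G∘χ°` — which also records «the cube and its mirror tile the torus» for ITS doubled torus; dag-n15-w5's box charts); objects here are King's.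

OBJECTS (data).  `foldZ m : ℤ∕2m → Fin m` (`val z` or its mirror `2m−1−val z`), `foldBox n : Tor (dblPer n) → KingBox n`, `highSet n w = {μ : n_μ ≤ val w_μ}`,
`tilingEquiv n : Finset (Fin (d+1)) × KingBox n ≃ Tor (dblPer n)`.

WHAT THIS FILE PROVES (kernel).  §1 `val_torReflS_dblBox_of_mem∕_of_not_mem`, `highSet_torReflS_dblBox`, ★ `foldBox_torReflS_dblBox` (folding undoes every
reflection), ★ `torReflS_highSet_dblBox_foldBox` (unfolding), ★★ **`tilingEquiv`**, ★ `sum_dblTorus_eq_sum_images`, `card_dblTorus_eq` (`|T(2n)| = 2^{d+1}|Ω|`),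
★ `kingBoxGreen_eq_sum_fibre`.  §2 `foldZ_eq_iff`, `natCast_ne_mirror`, ★ `sum_foldSlice_eq`.  §3 ★ `timeSlice_kingBoxGreen_eq_sum_foldSlice`, ★★★ **`timeSlice_kingBoxGreen_eq_pathGreen`**,
`timeSlice_kingBoxGreen_pos`, ★★ `timeSlice_kingBoxGreen_eq_cosh_mul_cosh`, ★★ `timeSlice_kingBoxGreen_eq_two_torusSlices`, ★ `sum_kingBoxGreen_eq_sum_dblTorus`.

HONEST SCOPE.  `c > 0`, `m² > 0` for the closed forms (the tiling and fibre statements need no sign); any `d`, any sides `n_μ ≥ 1`, any axis `κ`; zero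
transverse momentum only (the transverse Neumann modes are cosines, not characters — not treated).  King's `A = 0` scalar model; N15 untouched; counts
unmoved.  Locators: [King1986] §4 p.670, (4.4) p.670; [MontvayMunster1994] §2.1.2 (2.18)–(2.20), (2.49), §2.2.1 (2.74)–(2.76).
-/

noncomputable section

open scoped BigOperators symmDiff
open Finset Matrix

namespace Summit.QuantumFields.YangMills.BalabanUVNodes.N15KingModelRung.TorusSpectral

open Literature.MathematicalPhysics.QuantumFieldTheory.Balaban1983to89.B5Prop11Plancherel (Tor unitVec)
open Literature.MathematicalPhysics.QuantumFieldTheory.King1986.Torus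
open Summit.QuantumFields.YangMills.BalabanUVNodes.N15.TwoGrid (torRefl torRefl_torRefl torRefl_apply_same torRefl_apply_ne)
open Summit.QuantumFields.YangMills.BalabanUVNodes.N15KingModelRung.ProperTime (lapF_inv_nonneg lapF_inv_pos isUnit_lapF)

variable {d : ℕ}

/-! ## §1 Folding the doubled torus onto the box: the `2^{d+1}` reflected copies of `Ω` tile `Π_μ ℤ∕2n_μ` -/

section Tiling

variable (n : Fin (d + 1) → ℕ) [hn : ∀ μ, NeZero (n μ)]

/-- FOLDING one doubled coordinate onto the box interval: `z ↦ val z` if `val z < m`, else `z ↦ 2m − 1 − val z` (the mirror image). [cite: King1986, §4 p.670] -/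
def foldZ (m : ℕ) [NeZero m] (z : ZMod (2 * m)) : Fin m :=
  if h : z.val < m then ⟨z.val, h⟩ else ⟨2 * m - 1 - z.val, by have := NeZero.pos m; omega⟩

/-- FOLDING the doubled torus onto the box, coordinatewise. [cite: King1986, §4 p.670] -/
def foldBox (w : Tor (dblPer n)) : KingBox n := fun μ => foldZ (n μ) (w μ)

/-- The set of directions in which a point of the doubled torus lies in the MIRROR half (`val w_μ ≥ n_μ`). [folklore] -/
def highSet (w : Tor (dblPer n)) : Finset (Fin (d + 1)) := Finset.univ.filter fun μ => n μ ≤ (w μ).val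

/-- `val (σ_S(dblBox s))_μ = 2n_μ − 1 − s_μ` for `μ ∈ S`. [folklore] -/
theorem val_torReflS_dblBox_of_mem {S : Finset (Fin (d + 1))} {μ : Fin (d + 1)} (hμ : μ ∈ S) (s : KingBox n) :
    (torReflS (dblPer n) S (dblBox n s) μ).val = 2 * n μ - 1 - (s μ).val := by
  simp only [torReflS, hμ, if_true]
  exact val_mirror_dblBox n s μ

omit hn in
/-- `val (σ_S(dblBox s))_μ = s_μ` for `μ ∉ S`. [folklore] -/
theorem val_torReflS_dblBox_of_not_mem {S : Finset (Fin (d + 1))} {μ : Fin (d + 1)} (hμ : μ ∉ S) (s : KingBox n) :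
    (torReflS (dblPer n) S (dblBox n s) μ).val = (s μ).val := by
  simp only [torReflS, hμ, if_false]
  exact val_dblBox n s μ

/-- The mirror half is detected by `val`: `highSet (σ_S(dblBox s)) = S`. [folklore] -/
theorem highSet_torReflS_dblBox (S : Finset (Fin (d + 1))) (s : KingBox n) : highSet n (torReflS (dblPer n) S (dblBox n s)) = S := by
  ext μ
  simp only [highSet, Finset.mem_filter, Finset.mem_univ, true_and]
  by_cases hμ : μ ∈ S
  · rw [val_torReflS_dblBox_of_mem n hμ]
    have := (s μ).isLt
    have := NeZero.pos (n μ)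
    constructor
    · intro _; exact hμ
    · intro _; omega
  · rw [val_torReflS_dblBox_of_not_mem n hμ]
    constructor
    · intro h; exact absurd (s μ).isLt (not_lt.mpr h)
    · intro h; exact absurd h hμ

/-- Folding undoes every reflection: `foldBox (σ_S(dblBox s)) = s`. [cite: King1986, §4 p.670] -/
theorem foldBox_torReflS_dblBox (S : Finset (Fin (d + 1))) (s : KingBox n) : foldBox n (torReflS (dblPer n) S (dblBox n s)) = s := by
  funext μ
  simp only [foldBox, foldZ]
  by_cases hμ : μ ∈ S
  · have hv := val_torReflS_dblBox_of_mem n hμ s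
    have h1 := (s μ).isLt
    have hlt : ¬ (torReflS (dblPer n) S (dblBox n s) μ).val < n μ := by rw [hv]; omega
    rw [dif_neg hlt]
    apply Fin.ext
    simp only
    rw [hv]; omega
  · have hv := val_torReflS_dblBox_of_not_mem n hμ s
    have hlt : (torReflS (dblPer n) S (dblBox n s) μ).val < n μ := by rw [hv]; exact (s μ).isLt
    rw [dif_pos hlt]
    exact Fin.ext hv

/-- Unfolding: `σ_{highSet w}(dblBox (foldBox w)) = w` — every point of the doubled torus is a reflected image of exactly one box point. [cite: King1986, §4 p.670] -/
theorem torReflS_highSet_dblBox_foldBox (w : Tor (dblPer n)) : torReflS (dblPer n) (highSet n w) (dblBox n (foldBox n w)) = w := by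
  funext μ
  simp only [torReflS, highSet, Finset.mem_filter, Finset.mem_univ, true_and, dblBox, foldBox, foldZ]
  have hw : (w μ).val < 2 * n μ := ZMod.val_lt (w μ)
  by_cases h : n μ ≤ (w μ).val
  · have hlt : ¬ (w μ).val < n μ := not_lt.mpr h
    rw [if_pos h, dif_neg hlt]
    simp only
    have hc : (((2 * n μ - 1 - (w μ).val : ℕ) : ZMod (2 * n μ))) + (((w μ).val : ℕ) : ZMod (2 * n μ)) + 1
        = ((2 * n μ : ℕ) : ZMod (2 * n μ)) := by
      norm_cast; congr 1; omega
    rw [ZMod.natCast_self, ZMod.natCast_zmod_val] at hc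
    linear_combination -hc
  · have hlt : (w μ).val < n μ := not_le.mp h
    rw [if_neg h, dif_pos hlt]
    simp only
    exact ZMod.natCast_zmod_val (w μ)

/-- ★★ **THE REFLECTED BOXES TILE THE DOUBLED TORUS**: `(S, s) ↦ σ_S(dblBox s)` is a bijection `𝒫({0,…,d}) × Ω ≃ Π_μ ℤ∕2n_μ` (inverse: the mirror-half
set and the folding). [cite: King1986, §4 p.670] -/
def tilingEquiv : Finset (Fin (d + 1)) × KingBox n ≃ Tor (dblPer n) where
  toFun p := torReflS (dblPer n) p.1 (dblBox n p.2)
  invFun w := (highSet n w, foldBox n w)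
  left_inv p := by
    rcases p with ⟨S, s⟩
    simp only [highSet_torReflS_dblBox, foldBox_torReflS_dblBox]
  right_inv w := torReflS_highSet_dblBox_foldBox n w

/-- A sum over the doubled torus is a sum over the `2^{d+1}` reflected copies of the box. [cite: King1986, §4 p.670] -/
theorem sum_dblTorus_eq_sum_images {α : Type*} [AddCommMonoid α] (g : Tor (dblPer n) → α) :
    ∑ w : Tor (dblPer n), g w = ∑ S : Finset (Fin (d + 1)), ∑ s : KingBox n, g (torReflS (dblPer n) S (dblBox n s)) := by
  rw [← Fintype.sum_prod_type', ← Equiv.sum_comp (tilingEquiv n) g]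
  rfl

/-- Counting check: `|Π_μ ℤ∕2n_μ| = 2^{d+1}·|Ω|`. [folklore] -/
theorem card_dblTorus_eq : Fintype.card (Tor (dblPer n)) = 2 ^ (d + 1) * Fintype.card (KingBox n) := by
  rw [← Fintype.card_congr (tilingEquiv n), Fintype.card_prod, Fintype.card_finset, Fintype.card_fin]

/-- ★ **FIBRE FORM OF THE IMAGE SUM**: `G^{Ω}(s,t) = Σ_{w : foldBox w = t} B⁻¹_{T(2n)}(dblBox s, w)` — the box covariance collects the torus covariance over ALL
preimages of `t` under the folding map. [cite: King1986, §4 p.670] -/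
theorem kingBoxGreen_eq_sum_fibre (c m2 : ℝ) (s t : KingBox n) :
    kingBoxGreen n c m2 s t = ∑ w : Tor (dblPer n), (if foldBox n w = t then (lapF (dblPer n) c m2)⁻¹ (dblBox n s) w else 0) := by
  rw [sum_dblTorus_eq_sum_images]
  simp_rw [foldBox_torReflS_dblBox]
  unfold kingBoxGreen
  refine Finset.sum_congr rfl fun S _ => ?_
  rw [Finset.sum_ite_eq' Finset.univ t, if_pos (Finset.mem_univ _)]

end Tiling

/-! ## §2 The folded slice condition: `(foldBox w)_κ = a ↔ w_κ ∈ {a, −1 − a}` -/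

section Slices

variable (n : Fin (d + 1) → ℕ) [hn : ∀ μ, NeZero (n μ)] (κ : Fin (d + 1))

/-- `foldZ z = a ↔ z = a ∨ z = −1 − a` (the two preimages of a box coordinate). [folklore] -/
theorem foldZ_eq_iff (m : ℕ) [NeZero m] (z : ZMod (2 * m)) (a : Fin m) :
    foldZ m z = a ↔ (z = ((a.val : ℕ) : ZMod (2 * m)) ∨ z = -1 - ((a.val : ℕ) : ZMod (2 * m))) := by
  have hz : z.val < 2 * m := ZMod.val_lt z
  have ha := a.isLt
  have hmirror : (-1 - ((a.val : ℕ) : ZMod (2 * m)) : ZMod (2 * m)) = (((2 * m - 1 - a.val : ℕ)) : ZMod (2 * m)) := by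
    have hc : (((2 * m - 1 - a.val : ℕ) : ZMod (2 * m))) + ((a.val : ℕ) : ZMod (2 * m)) + 1 = ((2 * m : ℕ) : ZMod (2 * m)) := by
      norm_cast; congr 1; omega
    rw [ZMod.natCast_self] at hc
    linear_combination -hc
  constructor
  · intro h
    simp only [foldZ] at h
    by_cases hlt : z.val < m
    · rw [dif_pos hlt] at h
      have hv : z.val = a.val := by rw [← h]
      left
      rw [← ZMod.natCast_zmod_val z, hv]
    · rw [dif_neg hlt] at h
      have hv : 2 * m - 1 - z.val = a.val := by rw [← h]
      right
      rw [hmirror, ← ZMod.natCast_zmod_val z]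
      congr 1; omega
  · rintro (h | h)
    · subst h
      simp only [foldZ, ZMod.val_cast_of_lt (show a.val < 2 * m by omega), dif_pos ha]
    · subst h
      rw [hmirror]
      simp only [foldZ, ZMod.val_cast_of_lt (show 2 * m - 1 - a.val < 2 * m by omega)]
      rw [dif_neg (by omega)]
      apply Fin.ext; simp only; omega

/-- The two preimages are distinct: `a ≠ −1 − a` in `ℤ∕2n_κ`. [folklore] -/
theorem natCast_ne_mirror (m : ℕ) [NeZero m] (a : Fin m) :
    ((a.val : ℕ) : ZMod (2 * m)) ≠ -1 - ((a.val : ℕ) : ZMod (2 * m)) := by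
  intro h
  have hv := congrArg ZMod.val h
  rw [ZMod.val_cast_of_lt (show a.val < 2 * m by have := a.isLt; omega), val_neg_one_sub_natCast m (by have := a.isLt; omega)] at hv
  have := a.isLt
  omega

/-- ★ A FOLDED SLICE IS TWO TORUS SLICES: `Σ_{w : (foldBox w)_κ = a} g(w) = Σ_{w : w_κ = a} g(w) + Σ_{w : w_κ = −1−a} g(w)`. [cite: King1986, §4 p.670] -/
theorem sum_foldSlice_eq {α : Type*} [AddCommMonoid α] (g : Tor (dblPer n) → α) (a : Fin (n κ)) :
    ∑ w : Tor (dblPer n), (if foldBox n w κ = a then g w else 0)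
      = (∑ w : Tor (dblPer n), (if w κ = ((a.val : ℕ) : ZMod (2 * n κ)) then g w else 0))
        + ∑ w : Tor (dblPer n), (if w κ = -1 - ((a.val : ℕ) : ZMod (2 * n κ)) then g w else 0) := by
  rw [← Finset.sum_add_distrib]
  refine Finset.sum_congr rfl fun w _ => ?_
  have hiff := foldZ_eq_iff (n κ) (w κ) a
  simp only [foldBox] at hiff ⊢
  by_cases h1 : w κ = ((a.val : ℕ) : ZMod (2 * n κ))
  · have h2 : ¬ w κ = -1 - ((a.val : ℕ) : ZMod (2 * n κ)) := by rw [h1]; exact natCast_ne_mirror (n κ) a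
    rw [if_pos (hiff.mpr (Or.inl h1)), if_pos h1, if_neg h2, add_zero]
  · by_cases h2 : w κ = -1 - ((a.val : ℕ) : ZMod (2 * n κ))
    · rw [if_pos (hiff.mpr (Or.inr h2)), if_neg h1, if_pos h2, zero_add]
    · have h3 : ¬ foldZ (n κ) (w κ) = a := fun h => by rcases hiff.mp h with h' | h' <;> contradiction
      rw [if_neg h3, if_neg h1, if_neg h2, add_zero]

end Slices

/-! ## §3 The zero-momentum timeslices of the box covariance are the one-dimensional Neumann resolvent -/

section BoxTimeSlices

variable (n : Fin (d + 1) → ℕ) [hn : ∀ μ, NeZero (n μ)] (κ : Fin (d + 1))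

/-- ★ The timeslice of the box covariance, unfolded: `Σ_{s′ : s′_κ = a} G^{Ω}(s′,t) = Σ_{w : (foldBox w)_κ = a} B⁻¹_{T(2n)}(dblBox t, w)` (symmetry of `G^{Ω}`
and the tiling). [cite: King1986, §4 p.670] -/
theorem timeSlice_kingBoxGreen_eq_sum_foldSlice (c m2 : ℝ) (t : KingBox n) (a : Fin (n κ)) :
    ∑ s' : KingBox n, (if s' κ = a then kingBoxGreen n c m2 s' t else 0)
      = ∑ w : Tor (dblPer n), (if foldBox n w κ = a then (lapF (dblPer n) c m2)⁻¹ (dblBox n t) w else 0) := by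
  rw [sum_dblTorus_eq_sum_images]
  simp_rw [foldBox_torReflS_dblBox]
  rw [Finset.sum_comm]
  refine Finset.sum_congr rfl fun s' _ => ?_
  by_cases h : s' κ = a
  · simp only [h, if_true]
    rw [← kingBoxGreen_symm n c m2 s' t]
    rfl
  · simp only [h, if_false, Finset.sum_const_zero]

/-- ★★★ **THE ZERO-MOMENTUM TIMESLICES OF KING's FREE-BOUNDARY BOX COVARIANCE ARE THE ONE-DIMENSIONAL NEUMANN RESOLVENT WITH THE TORUS MASS.**  For
`c > 0`, `m² > 0`, every box `Ω = Π_μ{0,…,n_μ−1}`, every axis `κ`, every slice `a` and every source `t`: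
`Σ_{s′ ∈ Ω : s′_κ = a} (c(−Δ_free)+m²)⁻¹(s′,t) = c⁻¹ · pathGreen (n κ) (m²∕c) a t_κ = c⁻¹·cosh(ω₀(min(a,t_κ)+½))cosh(ω₀(n_κ−½−max(a,t_κ)))∕(sinh ω₀ sinh(ω₀n_κ))`,
`ω₀ = latticeMass(m²∕c)` — the SAME lattice mass as on the torus (part Ϲ-b): the free boundary changes the images, not the gap; the transverse free faces
drop out of the zero-momentum channel altogether (the folded transverse sum is the full transverse torus sum).
[cite: King1986, §4 p.670, (4.4) p.670; MontvayMunster1994, §2.1.2 (2.18)–(2.20), §2.2.1 (2.74)–(2.76)] -/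
theorem timeSlice_kingBoxGreen_eq_pathGreen {c m2 : ℝ} (hc : 0 < c) (hm : 0 < m2) (t : KingBox n) (a : Fin (n κ)) :
    ∑ s' : KingBox n, (if s' κ = a then kingBoxGreen n c m2 s' t else 0) = c⁻¹ * pathGreen (n κ) (m2 / c) a (t κ) := by
  rw [timeSlice_kingBoxGreen_eq_sum_foldSlice, sum_foldSlice_eq]
  have hsym : ∀ w : Tor (dblPer n), (lapF (dblPer n) c m2)⁻¹ (dblBox n t) w = (lapF (dblPer n) c m2)⁻¹ w (dblBox n t) :=
    fun w => lapF_inv_comm (dblPer n) c m2 _ _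
  simp_rw [hsym]
  rw [timeSlice_lapF_inv_eq_cycleGreen_source (dblPer n) κ hc hm (dblBox n t),
    timeSlice_lapF_inv_eq_cycleGreen_source (dblPer n) κ hc hm (dblBox n t), ← mul_add]
  congr 1
  unfold pathGreen
  have h1 : (((a.val : ℕ) : ZMod (2 * n κ)) - dblBox n t κ : ZMod (dblPer n κ)) = dbl (n κ) a - dbl (n κ) (t κ) := rfl
  have h2 : ((-1 - ((a.val : ℕ) : ZMod (2 * n κ))) - dblBox n t κ : ZMod (dblPer n κ)) = -(dbl (n κ) a - mirror (n κ) (t κ)) := by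
    simp only [dbl, mirror, dblBox]; ring
  rw [h1, h2, cycleGreen_neg]

/-- The box timeslice correlator is STRICTLY POSITIVE. [folklore] -/
theorem timeSlice_kingBoxGreen_pos {c m2 : ℝ} (hc : 0 < c) (hm : 0 < m2) (t : KingBox n) (a : Fin (n κ)) :
    0 < ∑ s' : KingBox n, (if s' κ = a then kingBoxGreen n c m2 s' t else 0) := by
  rw [timeSlice_kingBoxGreen_eq_pathGreen n κ hc hm]
  exact mul_pos (inv_pos.mpr hc) (pathGreen_pos (n κ) (div_pos hm hc) a (t κ))

/-- ★★ **CLOSED FORM** of the box timeslice correlator: `c⁻¹·cosh(ω₀(min(a,t_κ)+½))·cosh(ω₀(n_κ−½−max(a,t_κ)))∕(sinh ω₀ · sinh(ω₀ n_κ))`, `ω₀ = latticeMass(m²∕c)`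
— the textbook Neumann two-point function of the massive chain, with King's torus mass. [cite: King1986, §4 p.670; MontvayMunster1994, §2.2.1 (2.74)–(2.76)] -/
theorem timeSlice_kingBoxGreen_eq_cosh_mul_cosh {c m2 : ℝ} (hc : 0 < c) (hm : 0 < m2) (t : KingBox n) (a : Fin (n κ)) :
    ∑ s' : KingBox n, (if s' κ = a then kingBoxGreen n c m2 s' t else 0)
      = c⁻¹ * (Real.cosh (latticeMass (m2 / c) * ((min a.val (t κ).val : ℕ) + 1 / 2))
          * Real.cosh (latticeMass (m2 / c) * (n κ - 1 / 2 - (max a.val (t κ).val : ℕ)))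
          / (Real.sinh (latticeMass (m2 / c)) * Real.sinh (latticeMass (m2 / c) * n κ))) := by
  rw [timeSlice_kingBoxGreen_eq_pathGreen n κ hc hm, pathGreen_eq_cosh_mul_cosh]

/-- ★★ **BOX vs TORUS AT ZERO MOMENTUM, SAME GAP**: the box timeslice correlator equals the torus-`2n_κ` one of part Ϲ-b PLUS its mirror image,
`Σ_{s′_κ = a} G^{Ω}(s′,t) = Σ_{z_κ = a} B⁻¹_{T(2n)}(z, dblBox t) + Σ_{z_κ = −1−a} B⁻¹_{T(2n)}(z, dblBox t)` — King's `d = 1` reflection (part Ϲ-g) is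
EXACTLY what survives of the `d+1`-dimensional one in the zero-momentum channel. [cite: King1986, §4 p.670] -/
theorem timeSlice_kingBoxGreen_eq_two_torusSlices (c m2 : ℝ) (t : KingBox n) (a : Fin (n κ)) :
    ∑ s' : KingBox n, (if s' κ = a then kingBoxGreen n c m2 s' t else 0)
      = (∑ w : Tor (dblPer n), (if w κ = ((a.val : ℕ) : ZMod (2 * n κ)) then (lapF (dblPer n) c m2)⁻¹ w (dblBox n t) else 0))
        + ∑ w : Tor (dblPer n), (if w κ = -1 - ((a.val : ℕ) : ZMod (2 * n κ)) then (lapF (dblPer n) c m2)⁻¹ w (dblBox n t) else 0) := by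
  rw [timeSlice_kingBoxGreen_eq_sum_foldSlice, sum_foldSlice_eq]
  have hsym : ∀ w : Tor (dblPer n), (lapF (dblPer n) c m2)⁻¹ (dblBox n t) w = (lapF (dblPer n) c m2)⁻¹ w (dblBox n t) :=
    fun w => lapF_inv_comm (dblPer n) c m2 _ _
  simp_rw [hsym]

/-- ★ **THE FULL SUM OVER THE BOX IS THE FULL SUM OVER THE DOUBLED TORUS**: `Σ_{t ∈ Ω} G^{Ω}(s,t) = Σ_{w ∈ T(2n)} B⁻¹_{T(2n)}(dblBox s, w)` — whence the sum rule
`1∕m²` of part Ν-a′ is the torus sum rule. [cite: King1986, §4 p.670] -/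
theorem sum_kingBoxGreen_eq_sum_dblTorus (c m2 : ℝ) (s : KingBox n) :
    ∑ t : KingBox n, kingBoxGreen n c m2 s t = ∑ w : Tor (dblPer n), (lapF (dblPer n) c m2)⁻¹ (dblBox n s) w := by
  rw [sum_dblTorus_eq_sum_images, Finset.sum_comm]
  rfl

end BoxTimeSlices

end Summit.QuantumFields.YangMills.BalabanUVNodes.N15KingModelRung.TorusSpectral
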